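import Summits.KontsevichZagierPeriods.KontsevichZagierPeriods.Theorems.SymplecticScissorsRealOnePeriodRelationsStubHomotopyInvarianceAux
import Summits.KontsevichZagierPeriods.KontsevichZagierPeriods.Theorems.HermiteRigidityGenusTwoCycleTransferPushforwardDimOne
import Summits.KontsevichZagierPeriods.KontsevichZagierPeriods.Theorems.HermiteRigidityGenusTwoCycleTransferSemialgebraicInvFunOn
import Literature.NumberTheory.Transcendental.KZSemiCanonicalReductionDimOne
import Literature.NumberTheory.Transcendental.KZIntervalPeriodProofs

/-!
# `RealOnePeriodRelations`, line `nash-retraction-thin-strip`, stub `stub_cells` — auxiliary file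

The stub `stub_cells` of the crux `RealOnePeriodRelations` (stmt-KontsevichZagierPeriods-10042, route
`SymplecticScissors`) writes every `c ∈ H₁` modulo `M₁ = closure (1a ∪ 1b ∪ 2 ∪ Green)` as a
`ℤ`-combination of *unit cells*: representations on the unit interval `{z | z 0 ∈ (0,1)} ⊂ ℝ¹` whose
integrand is `C^∞` on `(0,1)`. This file supplies the bookkeeping and the single analytic input:

* `Cells.cellSpan` — the elements of `KZ.FormalRep` which are, modulo `M₁`, `ℤ`-combinations
  `Σ N(ρ) • [ρ]` (`N : IntegralRep 1 →₀ ℤ`) of unit cells; an additive subgroup containing `M₁`;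
* `helper_cells_1` (registered anchor) — Kontsevich–Zagier's rule (2) in dimension one, packaged from
  `HermiteRigidity.GenusTwoCycleTransfer.stub_pushforwardDimOne` with the semialgebraic inverse of
  `…stub_semialgebraicInvFunOn`: push `r` forward along an injective `φ` with semialgebraic
  nowhere-zero derivative;
* `Cells.of_mem_cellSpan_of_chart`, `Cells.of_mem_cellSpan_Ioo`, `Cells.of_mem_cellSpan_window` — a
  representation on an open cell `{z | z 0 ∈ I}` with smooth integrand, charted onto `(0,1)` by a
  semialgebraic diffeomorphism, is a unit cell modulo `M₁`; the affine chart of a bounded cell with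
  algebraic end points; the base case of the window induction of the main file.

References: M. Kontsevich, D. Zagier, *Periods* (2001), §1.2; J. Bochnak, M. Coste, M.-F. Roy, *Real
Algebraic Geometry* (1998), §2.2.
-/

noncomputable section

open Set MeasureTheory Filter Topology
open scoped ContDiff
open Literature.NumberTheory.Transcendental Literature.ModelTheory.ExponentialFields
open Summit.KontsevichZagierPeriods.SymplecticScissors.RealOnePeriodRelationsNegative (M₁ H₁)

namespace Summit.KontsevichZagierPeriods.SymplecticScissors.RealOnePeriodRelations

/-- **Rule (2) in dimension one, packaged** (registered anchor `helper_cells_1`). If `φ` is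
`ℚ`-semialgebraic on the domain of `r : KZ.IntegralRep 1` with a `ℚ`-semialgebraic nowhere-zero
derivative `φ'` there and `p ↦ (φ (p 0))` is injective on the domain, then the push-forward `s` of `r`
(domain the image, integrand `(r.integrand / |φ'|) ∘ Φ⁻¹`) satisfies `[r] − [s] ∈ M₁`.
[cite: KontsevichZagier2001, §1.2 rule (2)] -/
theorem helper_cells_1 : ∀ (r : KZ.IntegralRep 1) (φ φ' : ℝ → ℝ), IsSemialgebraicFunOn ℚ r.domain (fun p => φ (p 0)) → IsSemialgebraicFunOn ℚ r.domain (fun p => φ' (p 0)) → (∀ p ∈ r.domain, HasDerivAt φ (φ' (p 0)) (p 0)) → (∀ p ∈ r.domain, φ' (p 0) ≠ 0) → Set.InjOn (fun p : Fin 1 → ℝ => fun _ : Fin 1 => φ (p 0)) r.domain → ∃ s : KZ.IntegralRep 1, s.domain = (fun p : Fin 1 → ℝ => fun _ : Fin 1 => φ (p 0)) '' r.domain ∧ (∀ p ∈ r.domain, s.integrand (fun _ => φ (p 0)) = r.integrand p / |φ' (p 0)|) ∧ KZ.of r - KZ.of s ∈ M₁ := by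
  intro r φ φ' hφ hφ' hder hne hinj
  have hΦ : IsSemialgebraicMapOn ℚ r.domain (fun p : Fin 1 → ℝ => fun _ : Fin 1 => φ (p 0)) :=
    IsSemialgebraicMapOn.of_forall r.isSemialgebraic_domain fun _ => hφ
  have hG := HermiteRigidity.GenusTwoCycleTransfer.stub_semialgebraicInvFunOn hΦ hinj
  obtain ⟨s, hs, hsi, hrel⟩ := HermiteRigidity.GenusTwoCycleTransfer.stub_pushforwardDimOne r φ φ' _
    hφ hφ' hder hne hG (fun p hp => hinj.leftInvOn_invFunOn hp)
  exact ⟨s, hs, hsi, HomotopyInvariance.changeOfVariablesRel_subset hrel⟩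

namespace Cells

/-! ## `ℤ`-combinations of representations -/

/-- Additivity of `N ↦ Σ N(ρ) • [ρ]`. [folklore] -/
theorem combo_add (N N' : KZ.IntegralRep 1 →₀ ℤ) :
    ((N + N').sum fun ρ m => m • KZ.of ρ) = (N.sum fun ρ m => m • KZ.of ρ) + N'.sum fun ρ m => m • KZ.of ρ := by
  rw [Finsupp.sum_add_index']
  · exact fun a => zero_zsmul (KZ.of a)
  · exact fun a b₁ b₂ => add_zsmul (KZ.of a) b₁ b₂

/-- `Σ (−N)(ρ) • [ρ] = −Σ N(ρ) • [ρ]`. [folklore] -/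
theorem combo_neg (N : KZ.IntegralRep 1 →₀ ℤ) :
    ((-N).sum fun ρ m => m • KZ.of ρ) = -N.sum fun ρ m => m • KZ.of ρ := by
  rw [Finsupp.sum_neg_index]
  · simp only [neg_zsmul, Finsupp.sum_neg]
  · exact fun a => zero_zsmul (KZ.of a)

/-- `Σ δ_ρ(ρ') • [ρ'] = [ρ]`. [folklore] -/
theorem combo_single (ρ : KZ.IntegralRep 1) :
    ((Finsupp.single ρ (1 : ℤ)).sum fun ρ m => m • KZ.of ρ) = KZ.of ρ := by
  rw [Finsupp.sum_single_index (zero_zsmul _), one_zsmul]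

/-- The elements of `FormalRep` which are, modulo `M₁`, `ℤ`-combinations of *unit cells*
(representations on `{z | z 0 ∈ (0,1)}` whose integrand `t ↦ ρ.integrand (t)` is `C^∞` on `(0,1)`):
an additive subgroup. [cite: KontsevichZagier2001, §1.2] -/
def cellSpan : AddSubgroup KZ.FormalRep where
  carrier := {c | ∃ N : KZ.IntegralRep 1 →₀ ℤ,
    (∀ ρ ∈ N.support, ρ.domain = {z | z 0 ∈ Set.Ioo (0 : ℝ) 1} ∧
      ContDiffOn ℝ ((⊤ : ℕ∞) : WithTop ℕ∞) (fun t : ℝ => ρ.integrand (fun _ : Fin 1 => t))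
        (Set.Ioo (0 : ℝ) 1)) ∧
    c - N.sum (fun ρ m => m • KZ.of ρ) ∈ M₁}
  zero_mem' := ⟨0, by simp, by simp [M₁.zero_mem]⟩
  add_mem' := by
    classical
    rintro c c' ⟨N, hN, hcN⟩ ⟨N', hN', hcN'⟩
    refine ⟨N + N', fun ρ hρ => ?_, ?_⟩
    · rcases Finset.mem_union.mp (Finsupp.support_add hρ) with h | h
      · exact hN ρ h
      · exact hN' ρ h
    · rw [combo_add]
      convert M₁.add_mem hcN hcN' using 1
      abel
  neg_mem' := by
    rintro c ⟨N, hN, hcN⟩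
    refine ⟨-N, fun ρ hρ => hN ρ (by simpa [Finsupp.support_neg] using hρ), ?_⟩
    rw [combo_neg]
    convert M₁.neg_mem hcN using 1
    abel

/-- `M₁ ≤ cellSpan` (take `N = 0`). [folklore] -/
theorem mem_cellSpan_of_mem_M₁ {c : KZ.FormalRep} (hc : c ∈ M₁) : c ∈ cellSpan :=
  ⟨0, by simp, by simpa using hc⟩

/-- Transport along `M₁`: `c − c' ∈ M₁`, `c' ∈ cellSpan ⇒ c ∈ cellSpan`. [folklore] -/
theorem mem_cellSpan_of_sub_mem {c c' : KZ.FormalRep} (hc' : c' ∈ cellSpan) (h : c - c' ∈ M₁) :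
    c ∈ cellSpan := by
  have := cellSpan.add_mem (mem_cellSpan_of_mem_M₁ h) hc'
  rwa [sub_add_cancel] at this

/-- A unit cell lies in `cellSpan` (take `N = δ_ρ`). [folklore] -/
theorem of_mem_cellSpan_of_unitCell {ρ : KZ.IntegralRep 1}
    (hdom : ρ.domain = {z | z 0 ∈ Set.Ioo (0 : ℝ) 1})
    (hc : ContDiffOn ℝ ∞ (fun t : ℝ => ρ.integrand (fun _ : Fin 1 => t)) (Set.Ioo (0 : ℝ) 1)) :
    KZ.of ρ ∈ cellSpan := by
  classical
  refine ⟨Finsupp.single ρ 1, fun ρ' hρ' => ?_, ?_⟩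
  · rw [Finsupp.support_single _ one_ne_zero, Finset.mem_singleton] at hρ'
    rw [hρ']
    exact ⟨hdom, hc⟩
  · rw [combo_single, sub_self]
    exact M₁.zero_mem

/-- A representation with null domain lies in `cellSpan`. [cite: KontsevichZagier2001, §1.2 rule (1)] -/
theorem of_mem_cellSpan_of_null (r : KZ.IntegralRep 1) (h : volume r.domain = 0) :
    KZ.of r ∈ cellSpan :=
  mem_cellSpan_of_mem_M₁ (HomotopyInvariance.of_mem_of_volume_zero r h)

/-- **Splitting off a semialgebraic piece and its complement** (rule 1a): `[r] ∈ cellSpan` as soon as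
the restrictions of `r` to `r.domain ∩ t` and `r.domain ∩ tᶜ` are. [cite: KontsevichZagier2001, §1.2 rule (1)] -/
theorem of_mem_cellSpan_of_split_compl (r : KZ.IntegralRep 1) (t : Set (Fin 1 → ℝ))
    (ht : IsSemialgebraic ℚ t)
    (hc₁ : KZ.of (r.restrict (r.domain ∩ t) (r.isSemialgebraic_domain.inter ht) inter_subset_left) ∈
      cellSpan)
    (hc₂ : KZ.of (r.restrict (r.domain ∩ tᶜ) (r.isSemialgebraic_domain.inter ht.compl)
      inter_subset_left) ∈ cellSpan) : KZ.of r ∈ cellSpan := by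
  refine mem_cellSpan_of_sub_mem (cellSpan.add_mem hc₁ hc₂) ?_
  rw [← sub_sub]
  refine HomotopyInvariance.of_sub_sub_mem_of_cover r _ _ inter_subset_left inter_subset_left
    (fun _ _ => rfl) (fun _ _ => rfl) ?_ ?_
  · rw [KZ.IntegralRep.domain_restrict, KZ.IntegralRep.domain_restrict,
      show r.domain ∩ t ∩ (r.domain ∩ tᶜ) = ∅ by
        ext z; simp only [mem_inter_iff, mem_compl_iff, mem_empty_iff_false, iff_false]; tauto]
    exact measure_empty
  · rw [KZ.IntegralRep.domain_restrict, KZ.IntegralRep.domain_restrict, Set.inter_union_compl,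
      Set.sdiff_self]
    exact measure_empty

/-! ## Change of variables onto the unit interval -/

/-- A representation on a cell `{z | z 0 ∈ I}` with smooth integrand, charted onto `(0,1)` by a
semialgebraic map `φ : I → (0,1)` with positive smooth derivative and smooth inverse `ψ`, is a unit
cell modulo `M₁`: the push-forward has domain `{z | z 0 ∈ (0,1)}` and integrand
`u ↦ r.integrand (ψ u) / φ' (ψ u)` on it. [cite: KontsevichZagier2001, §1.2 rule (2)] -/
theorem of_mem_cellSpan_of_chart (r : KZ.IntegralRep 1) (I : Set ℝ)
    (hdom : r.domain = {z | z 0 ∈ I}) (φ φ' ψ : ℝ → ℝ)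
    (hφ : IsSemialgebraicFunOn ℚ r.domain (fun p => φ (p 0)))
    (hφ' : IsSemialgebraicFunOn ℚ r.domain (fun p => φ' (p 0)))
    (hder : ∀ t ∈ I, HasDerivAt φ (φ' t) t) (hpos : ∀ t ∈ I, 0 < φ' t)
    (hφ'c : ContDiffOn ℝ ∞ φ' I) (hmaps : MapsTo φ I (Ioo 0 1)) (hψmaps : MapsTo ψ (Ioo 0 1) I)
    (hψφ : ∀ t ∈ I, ψ (φ t) = t) (hφψ : ∀ u ∈ Ioo (0 : ℝ) 1, φ (ψ u) = u)
    (hψc : ContDiffOn ℝ ∞ ψ (Ioo 0 1))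
    (hf : ContDiffOn ℝ ∞ (fun t => r.integrand (fun _ => t)) I) : KZ.of r ∈ cellSpan := by
  have hmem : ∀ t : ℝ, (fun _ : Fin 1 => t) ∈ r.domain ↔ t ∈ I := fun t => by rw [hdom]; rfl
  have hmem' : ∀ p : Fin 1 → ℝ, p ∈ r.domain → p 0 ∈ I := fun p hp => by rw [hdom] at hp; exact hp
  have hinj : InjOn (fun p : Fin 1 → ℝ => fun _ : Fin 1 => φ (p 0)) r.domain := by
    intro p hp p' hp' h
    have h0 : φ (p 0) = φ (p' 0) := congrFun h 0
    have : p 0 = p' 0 := by rw [← hψφ _ (hmem' p hp), ← hψφ _ (hmem' p' hp'), h0]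
    rw [KZ.eq_const_apply_zero p, KZ.eq_const_apply_zero p', this]
  obtain ⟨s, hsdom, hsi, hrel⟩ := helper_cells_1 r φ φ' hφ hφ' (fun p hp => hder _ (hmem' p hp))
    (fun p hp => (hpos _ (hmem' p hp)).ne') hinj
  refine mem_cellSpan_of_sub_mem (of_mem_cellSpan_of_unitCell ?_ ?_) hrel
  · rw [hsdom]
    ext z
    constructor
    · rintro ⟨p, hp, rfl⟩
      exact hmaps (hmem' p hp)
    · intro hz
      refine ⟨fun _ => ψ (z 0), (hmem _).mpr (hψmaps hz), ?_⟩
      rw [KZ.eq_const_apply_zero z]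
      funext
      simp only [hφψ _ hz]
  · have hg : ContDiffOn ℝ ∞ (fun u => r.integrand (fun _ => ψ u) / φ' (ψ u)) (Ioo 0 1) := by
      refine ContDiffOn.div ?_ ?_ fun u hu => (hpos _ (hψmaps hu)).ne'
      · exact hf.comp hψc hψmaps
      · exact hφ'c.comp hψc hψmaps
    refine hg.congr fun u hu => ?_
    have h := hsi (fun _ => ψ u) ((hmem _).mpr (hψmaps hu))
    rw [hφψ u hu, abs_of_pos (hpos _ (hψmaps hu))] at h
    exact h

/-- **A bounded open cell** `{z | z 0 ∈ (a, b)}` with algebraic end points and smooth integrand is a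
unit cell modulo `M₁`: the affine chart `t ↦ (t − a)/(b − a)` is `ℚ`-semialgebraic because `a`, `b`
are algebraic. [cite: KontsevichZagier2001, §1.2 rule (2)] -/
theorem of_mem_cellSpan_Ioo (r : KZ.IntegralRep 1) {a b : ℝ} (hab : a < b) (ha : IsAlgebraic ℚ a)
    (hb : IsAlgebraic ℚ b) (hdom : r.domain = {z | z 0 ∈ Ioo a b})
    (hf : ContDiffOn ℝ ∞ (fun t => r.integrand (fun _ => t)) (Ioo a b)) : KZ.of r ∈ cellSpan := by
  have hσ := r.isSemialgebraic_domain
  have hba : b - a ≠ 0 := (sub_pos.mpr hab).ne'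
  have hk : 0 < (b - a)⁻¹ := inv_pos.mpr (sub_pos.mpr hab)
  have hkalg : IsAlgebraic ℚ (b - a)⁻¹ := (hb.sub ha).inv
  refine of_mem_cellSpan_of_chart r (Ioo a b) hdom (fun t => (t - a) * (b - a)⁻¹) (fun _ => (b - a)⁻¹)
    (fun u => a + (b - a) * u) ?_ ?_ ?_ (fun _ _ => hk) contDiffOn_const ?_ ?_ ?_ ?_ ?_ hf
  · exact ((isSemialgebraicFunOn_apply hσ 0).fun_sub
      (isSemialgebraicFunOn_const_of_isAlgebraic hσ ha)).fun_mul
      (isSemialgebraicFunOn_const_of_isAlgebraic hσ hkalg)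
  · exact isSemialgebraicFunOn_const_of_isAlgebraic hσ hkalg
  · intro t _
    simpa using ((hasDerivAt_id t).sub_const a).mul_const (b - a)⁻¹
  · intro t ht
    dsimp only
    rw [← div_eq_mul_inv]
    exact ⟨div_pos (sub_pos.mpr ht.1) (sub_pos.mpr hab),
      (div_lt_one (sub_pos.mpr hab)).mpr (by linarith [ht.2])⟩
  · intro u hu
    constructor <;> nlinarith [hu.1, hu.2, sub_pos.mpr hab]
  · intro t _
    field_simp
    ring
  · intro u _
    field_simp
    ring
  · exact (contDiff_const.add (contDiff_const.mul contDiff_id)).contDiffOn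

/-- **Base case of the window induction**: a representation inside a window `(a, b)` with algebraic
end points which fills the window (with smooth integrand) or misses it lies in `cellSpan`.
[cite: KontsevichZagier2001, §1.2] -/
theorem of_mem_cellSpan_window (r : KZ.IntegralRep 1) {a b : ℝ} (ha : IsAlgebraic ℚ a)
    (hb : IsAlgebraic ℚ b) (hdom : r.domain ⊆ {z | z 0 ∈ Ioo a b})
    (H1 : {z : Fin 1 → ℝ | z 0 ∈ Ioo a b} ⊆ r.domain ∨ Disjoint {z : Fin 1 → ℝ | z 0 ∈ Ioo a b} r.domain)
    (H2 : {z : Fin 1 → ℝ | z 0 ∈ Ioo a b} ⊆ r.domain →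
      ContDiffOn ℝ ∞ (fun t => r.integrand (fun _ => t)) (Ioo a b)) : KZ.of r ∈ cellSpan := by
  rcases H1 with h | h
  · rcases lt_or_ge a b with hab | hab
    · exact of_mem_cellSpan_Ioo r hab ha hb (hdom.antisymm h) (H2 h)
    · refine of_mem_cellSpan_of_null r (measure_mono_null hdom ?_)
      rw [Ioo_eq_empty (not_lt.mpr hab)]
      simp
  · refine of_mem_cellSpan_of_null r ?_
    rw [h.symm.eq_bot_of_le hdom]
    exact measure_empty

end Cells

end Summit.KontsevichZagierPeriods.SymplecticScissors.RealOnePeriodRelations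

end
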